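import Literature.Analysis.FluidPDE.LeiZhang2011StreamRescaling
import Literature.Analysis.FunctionSpaces.BMOCarlesonConverse
import HarnessLib

/-!
# Lei–Zhang 2011, Theorem 1.4 — the heat-flow gauge, I: the caloric extension of a `BMO`
# function is in `BMO` and is `C¹`

Analysis/FluidPDE **proofs file** (theorems only: no definitions, no named facts, no `sorry`)
on the discharge path of `Literature.Analysis.FluidPDE.LeiZhang2011_regularity_bmoStream`
(Z. Lei, Q. S. Zhang, J. Funct. Anal. 261 (2011) = arXiv:1011.5066, **Theorem 1.4**). The
swirl step of the blow-up argument (`LeiZhang2011RegularityUniform`, hypothesis `hstep`) is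
Theorem 1.2 of the paper applied to the blow-up limit, whose stream function is only a
*distributional* `L^∞_t BMO_x` potential (`exists_bmoStream_of_tendstoUniformlyOn`), while the
tree's Theorem 1.2 (`LeiZhang2011.LeiZhang2011_liouville_holds`) asks for *differentiable* stream
slices. The gap is closed by a **heat-flow gauge**: `B' = e^{Δ}B + ∫₀¹ e^{σΔ} curl v dσ`. This
first file supplies the two facts about `e^{Δ}B` that do not involve the curl:

* `eBMOSeminorm_heatExtension_le` — **`‖e^{tΔ}f‖_* ≤ ‖f‖_*`** for `f ∈ BMO` (Minkowski's
  inequality: `e^{tΔ}f − (e^{tΔ}f)_{B(x,r)} = ∫ K_t(w) (f(· − w) − f_{B(x−w,r)}) dw`, and the mean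
  oscillation of a translate over `B(x, r)` is the mean oscillation over `B(x − w, r)`);
* `hasFDerivAt_heatExtension_of_growth` — for `f` of Stein growth
  `∫ |f| (1 + ‖y‖)^{-K} < ∞` (in particular `f ∈ BMO`, Grafakos Prop. 3.1.5 (ii)), `e^{tΔ}f` is
  differentiable with `D(e^{tΔ}f)(y) v = ⟪∇e^{tΔ}f (y), v⟫`, `∇e^{tΔ}f = heatExtensionGrad f t`
  (differentiation under the integral sign against the Gaussian weights of
  `BMOCarlesonDuality`).

## References

* Z. Lei, Q. S. Zhang, J. Funct. Anal. 261 (2011) = arXiv:1011.5066, Thm. 1.4 and §4.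
  [LeiZhang2011]
* L. Grafakos, *Modern Fourier Analysis*, 3rd ed., Prop. 3.1.2 (6) and Prop. 3.1.5 (ii).
  [GrafakosMFA2014]
* E. M. Stein, *Harmonic Analysis* (1993), Ch. IV §1.1. [SteinHA1993]
-/

noncomputable section

open MeasureTheory Set Function Filter Topology Metric
open scoped InnerProductSpace RealInnerProductSpace NNReal ENNReal

namespace Literature.Analysis.FluidPDE

open Literature.Analysis.FunctionSpaces Literature.Analysis.FunctionSpaces.BMOInv

section HeatBMO

variable {E : Type*} [NormedAddCommGroup E] [InnerProductSpace ℝ E] [FiniteDimensional ℝ E]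
  [MeasurableSpace E] [BorelSpace E]

/-- The convolution form of the caloric extension: `e^{tΔ}f (y) = ∫ K_t(w) f(y − w) dw`.
[folklore] -/
theorem heatExtension_eq_integral_comp_sub (f : E → ℝ) (t : ℝ) (y : E) :
    heatExtension f t y = ∫ w, heatKernel t w * f (y - w) := by
  rw [heatExtension, ← integral_sub_left_eq_self (fun z => heatKernel t (y - z) * f z) volume y]
  simp only [sub_sub_cancel]

omit [FiniteDimensional ℝ E] [MeasurableSpace E] [BorelSpace E] in
/-- The two heat kernels of the tree (`FunctionSpaces.BMOInv.heatKernel` and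
`UnboundedOperators.heatKernel`) are the same function. [folklore] -/
theorem bmoInv_heatKernel_eq (t : ℝ) (z : E) :
    heatKernel t z = Literature.Analysis.UnboundedOperators.heatKernel t z := rfl

/-- `(y, w) ↦ f(y − w)` is a.e.-strongly measurable on `B × E` (`B ⊆ E` measurable or not) for
an a.e.-strongly measurable `f` (subtraction is quasi-measure-preserving). [folklore] -/
theorem aestronglyMeasurable_comp_sub_restrict_prod {f : E → ℝ}
    (hfm : AEStronglyMeasurable f volume) (s : Set E) :
    AEStronglyMeasurable (fun p : E × E => f (p.1 - p.2)) ((volume.restrict s).prod volume) := by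
  have hle : (volume : Measure E).restrict s ≤ volume := Measure.restrict_le_self
  have hac : ((volume : Measure E).restrict s).prod (volume : Measure E) ≪
      (volume : Measure E).prod (volume : Measure E) :=
    Measure.AbsolutelyContinuous.prod hle.absolutelyContinuous Measure.AbsolutelyContinuous.rfl
  exact (hfm.comp_quasiMeasurePreserving
    (quasiMeasurePreserving_sub_of_right_invariant volume volume)).mono_ac hac

/-- The integrand `(y, w) ↦ K_t(w) f(y − w)` of the caloric extension is a.e.-strongly
measurable on `B × E`. [folklore] -/
theorem aestronglyMeasurable_heatKernel_mul_comp_sub {f : E → ℝ}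
    (hfm : AEStronglyMeasurable f volume) (t : ℝ) (s : Set E) :
    AEStronglyMeasurable (fun p : E × E => heatKernel t p.2 * f (p.1 - p.2))
      ((volume.restrict s).prod volume) :=
  ((contDiff_heatKernel (E := E) t (n := 0)).continuous.comp
    continuous_snd).aestronglyMeasurable.mul
    (aestronglyMeasurable_comp_sub_restrict_prod hfm s)

/-- The integrand `(y, w) ↦ K_t(w) f(y − w)` of the caloric extension is integrable on
`B × E` for every ball `B` when `f` has Stein growth (the `y`-integral of its absolute value is
`e^{tΔ}|f| (y) ≤ C (1 + ‖y‖)^K`, bounded on `B`). [folklore] -/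
theorem integrable_prod_heatKernel_mul_comp_sub {f : E → ℝ} {K : ℕ}
    (hfw : Integrable fun w => ((1 + ‖w‖) ^ K)⁻¹ * f w) {t : ℝ} (ht : 0 < t) (x : E) (r : ℝ) :
    Integrable (fun p : E × E => heatKernel t p.2 * f (p.1 - p.2))
      ((volume.restrict (ball x r)).prod volume) := by
  set μB : Measure E := volume.restrict (ball x r) with hμB
  have hfm : AEStronglyMeasurable f volume := aestronglyMeasurable_of_growth hfw
  have hFm : AEStronglyMeasurable (fun p : E × E => heatKernel t p.2 * f (p.1 - p.2))
      (μB.prod volume) := aestronglyMeasurable_heatKernel_mul_comp_sub hfm t (ball x r)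
  rw [integrable_prod_iff hFm]
  refine ⟨Eventually.of_forall fun y => ?_, ?_⟩
  · have h := (integrable_heatKernel_mul_of_growth hfw ht y).comp_sub_left y
    refine h.congr (Eventually.of_forall fun w => ?_)
    simp only [sub_sub_cancel]
  · -- `y ↦ ∫ |K_t(w) f(y − w)| dw = e^{tΔ}|f| (y)` is bounded on the ball
    obtain ⟨C, hC0, hC⟩ := exists_unif_bound_heatExtension (integrable_growth_abs hfw) ht le_rfl
    have heq : ∀ y, ∫ w, ‖heatKernel t w * f (y - w)‖ = heatExtension (fun z => |f z|) t y := by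
      intro y
      rw [heatExtension_eq_integral_comp_sub]
      refine integral_congr_ae (Eventually.of_forall fun w => ?_)
      show ‖heatKernel t w * f (y - w)‖ = heatKernel t w * |f (y - w)|
      rw [norm_mul, Real.norm_of_nonneg (show (0 : ℝ) ≤ heatKernel t w from
        (Literature.Analysis.UnboundedOperators.heatKernel_pos ht w).le), Real.norm_eq_abs]
    have hbd : ∀ y ∈ ball x r, ‖∫ w, ‖heatKernel t w * f (y - w)‖‖ ≤ C * (1 + (‖x‖ + r)) ^ K := by
      intro y hy
      rw [heq, Real.norm_eq_abs]
      refine (hC t ⟨le_rfl, le_rfl⟩ y).trans ?_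
      have hy' : ‖y‖ ≤ ‖x‖ + r := by
        have h1 : ‖y - x‖ < r := by rwa [mem_ball_iff_norm] at hy
        linarith [norm_le_norm_add_norm_sub' y x, norm_sub_rev y x]
      gcongr
    have hconst : IntegrableOn (fun _ : E => C * (1 + (‖x‖ + r)) ^ K) (ball x r) volume :=
      integrableOn_const measure_ball_lt_top.ne
    refine Integrable.mono' hconst hFm.norm.integral_prod_right' ?_
    exact (ae_restrict_iff' measurableSet_ball).2 (Eventually.of_forall hbd)

/-- Positive-radius balls have positive finite Lebesgue measure. [folklore] -/
theorem volume_ball_ne_zero_ne_top (x : E) {r : ℝ} (hr : 0 < r) :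
    volume (ball x r) ≠ 0 ∧ volume (ball x r) ≠ ⊤ :=
  ⟨(measure_ball_pos volume x hr).ne', measure_ball_lt_top.ne⟩

/-- **The caloric extension does not increase the `BMO` seminorm**: `‖e^{tΔ}f‖_* ≤ ‖f‖_*`
for `f ∈ BMO(E)` and `t > 0` (Grafakos, *Modern Fourier Analysis*, Prop. 3.1.2 (6):
translation invariance, averaged against the probability density `K_t` by Minkowski's
inequality). With `A(w) = f_{B(x−w,r)}`: `(e^{tΔ}f)_{B(x,r)} = ∫ K_t(w) A(w) dw` (Fubini), so
`⨍_{B(x,r)} |e^{tΔ}f − (e^{tΔ}f)_B| ≤ ∫ K_t(w) ⨍_{B(x−w,r)} |f − f_{B(x−w,r)}| dw ≤ ‖f‖_*`.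
[cite: GrafakosMFA2014, Prop. 3.1.2 (6)] -/
theorem eBMOSeminorm_heatExtension_le {f : E → ℝ} (hf : MemBMO f) {t : ℝ} (ht : 0 < t) :
    eBMOSeminorm (heatExtension f t) ≤ eBMOSeminorm f := by
  have hfw : Integrable fun w => ((1 + ‖w‖) ^ (Module.finrank ℝ E + 1))⁻¹ * f w :=
    MemBMO.integrable_inv_one_add_norm_pow_mul_holds hf
  have hfm : AEStronglyMeasurable f volume := hf.locallyIntegrable.aestronglyMeasurable
  refine iSup_le fun x => iSup₂_le fun r hr => ?_
  obtain ⟨hB0, hBtop⟩ := volume_ball_ne_zero_ne_top x hr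
  -- the integrand and its product integrability
  set F : E × E → ℝ := fun p => heatKernel t p.2 * f (p.1 - p.2) with hF
  have hFint : Integrable F ((volume.restrict (ball x r)).prod volume) :=
    integrable_prod_heatKernel_mul_comp_sub hfw ht x r
  -- the caloric extension in convolution form
  have hh : ∀ y, heatExtension f t y = ∫ w, F (y, w) := fun y =>
    heatExtension_eq_integral_comp_sub f t y
  -- the averages of the translates, `A w = f_{B(x − w, r)}`
  set A : E → ℝ := fun w => ⨍ y in ball x r, f (y - w) with hA
  have hA' : ∀ w, A w = ⨍ y in ball (x + -w) r, f y := fun w => by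
    simp only [hA, sub_eq_add_neg]
    exact setAverage_ball_comp_add_right volume f (-w) x r
  -- Fubini: the average of `e^{tΔ}f` over the ball
  have hAint : Integrable (fun w => ∫ y, F (y, w) ∂(volume.restrict (ball x r))) volume :=
    hFint.integral_prod_right
  have hinner : ∀ w, ∫ y, F (y, w) ∂(volume.restrict (ball x r)) =
      heatKernel t w * ∫ y in ball x r, f (y - w) := fun w => by
    simp only [hF]
    exact integral_const_mul _ _
  have hKA : Integrable (fun w => heatKernel t w * A w) volume := by
    have h := hAint.const_mul (volume.real (ball x r))⁻¹
    refine h.congr (Eventually.of_forall fun w => ?_)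
    simp only [hinner, hA, setAverage_eq, smul_eq_mul]
    ring
  have havg : ⨍ y in ball x r, heatExtension f t y = ∫ w, heatKernel t w * A w := by
    rw [setAverage_eq, smul_eq_mul]
    have h1 : ∫ y in ball x r, heatExtension f t y =
        ∫ y, ∫ w, F (y, w) ∂volume ∂(volume.restrict (ball x r)) :=
      integral_congr_ae (Eventually.of_forall hh)
    rw [h1, integral_integral_swap hFint]
    simp only [hinner, hA, setAverage_eq, smul_eq_mul]
    rw [← integral_const_mul]
    refine integral_congr_ae (Eventually.of_forall fun w => ?_)
    ring
  -- pointwise: `e^{tΔ}f (y) − average = ∫ K_t(w) (f(y − w) − A w) dw`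
  have hFy : ∀ y, Integrable (fun w => F (y, w)) volume := fun y => by
    have h := (integrable_heatKernel_mul_of_growth hfw ht y).comp_sub_left y
    refine h.congr (Eventually.of_forall fun w => ?_)
    simp only [hF, sub_sub_cancel]
  have hdiff : ∀ y, heatExtension f t y - ⨍ z in ball x r, heatExtension f t z =
      ∫ w, heatKernel t w * (f (y - w) - A w) := fun y => by
    rw [havg, hh, ← integral_sub (hFy y) hKA]
    refine integral_congr_ae (Eventually.of_forall fun w => ?_)
    simp only [hF]
    ring
  -- the pointwise `ℝ≥0∞` bound
  have hpt : ∀ y, ‖heatExtension f t y - ⨍ z in ball x r, heatExtension f t z‖ₑ ≤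
      ∫⁻ w, ‖heatKernel t w‖ₑ * ‖f (y - w) - A w‖ₑ := fun y => by
    rw [hdiff]
    refine (enorm_integral_le_lintegral_enorm _).trans (le_of_eq ?_)
    simp only [enorm_mul]
  -- measurability on the product for Tonelli
  have hsub : AEStronglyMeasurable (fun p : E × E => f (p.1 - p.2))
      ((volume.restrict (ball x r)).prod volume) :=
    aestronglyMeasurable_comp_sub_restrict_prod hfm (ball x r)
  have hAm : AEStronglyMeasurable A volume := by
    -- `A w = (vol B)⁻¹ (K_t w)⁻¹ ∫_B F(·, w)`
    have hKi : Continuous fun w : E => (heatKernel t w)⁻¹ :=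
      (contDiff_heatKernel (E := E) t (n := 0)).continuous.inv₀ fun w =>
        (Literature.Analysis.UnboundedOperators.heatKernel_pos ht w).ne'
    have h1 : AEStronglyMeasurable (fun w => (volume.real (ball x r))⁻¹ *
        ((heatKernel t w)⁻¹ * ∫ y, F (y, w) ∂(volume.restrict (ball x r)))) volume :=
      aestronglyMeasurable_const.mul (hKi.aestronglyMeasurable.mul hAint.aestronglyMeasurable)
    refine h1.congr (Eventually.of_forall fun w => ?_)
    have hK : heatKernel t w ≠ 0 :=
      (Literature.Analysis.UnboundedOperators.heatKernel_pos ht w).ne'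
    simp only [hinner, hA, setAverage_eq, smul_eq_mul]
    rw [← mul_assoc (heatKernel t w)⁻¹, inv_mul_cancel₀ hK, one_mul]
  have hGm : AEMeasurable (uncurry fun (y w : E) => ‖heatKernel t w‖ₑ * ‖f (y - w) - A w‖ₑ)
      ((volume.restrict (ball x r)).prod volume) := by
    have h1 : AEStronglyMeasurable (fun p : E × E => heatKernel t p.2)
        ((volume.restrict (ball x r)).prod volume) :=
      ((contDiff_heatKernel (E := E) t (n := 0)).continuous.comp
        continuous_snd).aestronglyMeasurable
    have h2 : AEStronglyMeasurable (fun p : E × E => A p.2)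
        ((volume.restrict (ball x r)).prod volume) := hAm.comp_snd
    exact (h1.enorm.mul (hsub.sub h2).enorm)
  -- the mean oscillation of a translate over `B(x, r)`
  have hosc : ∀ w, ∫⁻ y in ball x r, ‖f (y - w) - A w‖ₑ ≤ eBMOSeminorm f * volume (ball x r) := by
    intro w
    have h1 : ⨍⁻ y in ball x r, ‖f (y - w) - A w‖ₑ ∂volume ≤ eBMOSeminorm f := by
      have h2 := setLAverage_ball_comp_add_right volume (fun y => ‖f y - A w‖ₑ) (-w) x r
      simp only [← sub_eq_add_neg] at h2
      rw [h2, hA']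
      simp only [← sub_eq_add_neg]
      exact laverage_oscillation_le_eBMOSeminorm f volume (x - w) hr
    rw [setLAverage_eq] at h1
    exact (ENNReal.div_le_iff_le_mul (Or.inl hB0) (Or.inl hBtop)).1 h1
  -- assemble
  have step1 : ∫⁻ y in ball x r, ‖heatExtension f t y - ⨍ z in ball x r, heatExtension f t z‖ₑ ≤
      ∫⁻ y in ball x r, ∫⁻ w, ‖heatKernel t w‖ₑ * ‖f (y - w) - A w‖ₑ :=
    lintegral_mono fun y => hpt y
  have step2 : ∫⁻ y in ball x r, ∫⁻ w, ‖heatKernel t w‖ₑ * ‖f (y - w) - A w‖ₑ =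
      ∫⁻ w, ∫⁻ y in ball x r, ‖heatKernel t w‖ₑ * ‖f (y - w) - A w‖ₑ :=
    lintegral_lintegral_swap hGm
  have step3 : ∫⁻ w, ∫⁻ y in ball x r, ‖heatKernel t w‖ₑ * ‖f (y - w) - A w‖ₑ =
      ∫⁻ w, ‖heatKernel t w‖ₑ * ∫⁻ y in ball x r, ‖f (y - w) - A w‖ₑ :=
    lintegral_congr fun w => lintegral_const_mul' _ _ enorm_ne_top
  have step4 : ∫⁻ w, ‖heatKernel t w‖ₑ * ∫⁻ y in ball x r, ‖f (y - w) - A w‖ₑ ≤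
      ∫⁻ w : E, ‖heatKernel t w‖ₑ * (eBMOSeminorm f * volume (ball x r)) :=
    lintegral_mono fun w => mul_le_mul_right (hosc w) _
  have hK1 : ∫⁻ w : E, ‖heatKernel t w‖ₑ = 1 := by
    simp_rw [bmoInv_heatKernel_eq]
    exact Literature.Analysis.UnboundedOperators.lintegral_enorm_heatKernel ht
  have step5 : ∫⁻ w : E, ‖heatKernel t w‖ₑ * (eBMOSeminorm f * volume (ball x r)) =
      eBMOSeminorm f * volume (ball x r) := by
    rw [lintegral_mul_const' _ _ (ENNReal.mul_ne_top hf.eBMOSeminorm_lt_top.ne hBtop), hK1,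
      one_mul]
  rw [setLAverage_eq]
  refine ENNReal.div_le_of_le_mul ?_
  exact step1.trans (step2.trans_le (step3.trans_le (step4.trans_eq step5)))

/-! ### Differentiability of the caloric extension of a function of Stein growth -/

omit [MeasurableSpace E] [BorelSpace E] in
/-- `y ↦ K_t(y − z)` has derivative `⟪∇K_t(y − z), ·⟫`. [folklore] -/
theorem hasFDerivAt_heatKernel_sub_left (t : ℝ) (y z : E) :
    HasFDerivAt (fun y : E => heatKernel t (y - z)) (innerSL ℝ (heatKernelGrad t (y - z))) y := by
  haveI : CompleteSpace E := FiniteDimensional.complete ℝ E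
  have h1 := (hasGradientAt_heatKernel t (y - z)).hasFDerivAt
  have h2 : HasFDerivAt (fun y : E => y - z) (ContinuousLinearMap.id ℝ E) y :=
    (hasFDerivAt_id y).sub_const z
  refine (h1.comp y h2).congr_fderiv ?_
  ext v
  simp [InnerProductSpace.toDual_apply_apply]

/-- **The caloric extension of a function of Stein growth is `C¹`**: for
`∫ |f| (1 + ‖w‖)^{-K} < ∞` and `t > 0`, `e^{tΔ}f` has the Fréchet derivative
`D(e^{tΔ}f)(y) = ⟪∇e^{tΔ}f (y), ·⟫` with
`∇e^{tΔ}f (y) = heatExtensionGrad f t y = ∫ f(z) ∇K_t(y − z) dz`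
(differentiation under the integral sign, dominated through the Gaussian weight bounds
`(1 + ‖u‖)^K ‖∇K_t(u)‖ ≤ C` and Peetre's inequality; Evans, *PDE*, §2.3.1 Thm. 1 for bounded
data). [folklore] -/
theorem hasFDerivAt_heatExtension_of_growth {f : E → ℝ} {K : ℕ}
    (hfw : Integrable fun w => ((1 + ‖w‖) ^ K)⁻¹ * f w) {t : ℝ} (ht : 0 < t) (y₀ : E) :
    HasFDerivAt (heatExtension f t) (innerSL ℝ (heatExtensionGrad f t y₀)) y₀ := by
  have hfm : AEStronglyMeasurable f volume := aestronglyMeasurable_of_growth hfw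
  obtain ⟨C, hC0, hC⟩ := exists_unif_bound_heatKernelGrad (E := E) K ht le_rfl
  -- the dominating function
  set bound : E → ℝ := fun z => C * (2 + ‖y₀‖) ^ K * ‖((1 + ‖z‖) ^ K)⁻¹ * f z‖ with hbound
  have hbint : Integrable bound volume := hfw.norm.const_mul _
  -- the kernel-gradient bound on the unit ball about `y₀`
  have hker : ∀ z, ∀ y ∈ ball y₀ 1,
      ‖heatKernelGrad t (y - z)‖ ≤ C * (2 + ‖y₀‖) ^ K * ((1 + ‖z‖) ^ K)⁻¹ := by
    intro z y hy
    have hy1 : 1 + ‖y‖ ≤ 2 + ‖y₀‖ := by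
      have h : ‖y - y₀‖ < 1 := by rwa [mem_ball_iff_norm] at hy
      linarith [norm_le_norm_add_norm_sub' y y₀, norm_sub_rev y y₀]
    have hzK : 0 < (1 + ‖z‖) ^ K := by positivity
    have h1 : (1 + ‖z‖) ^ K * ‖heatKernelGrad t (y - z)‖ ≤ (2 + ‖y₀‖) ^ K * C := by
      calc (1 + ‖z‖) ^ K * ‖heatKernelGrad t (y - z)‖
          ≤ (1 + ‖y‖) ^ K * (1 + ‖y - z‖) ^ K * ‖heatKernelGrad t (y - z)‖ := by
            gcongr
            exact one_add_norm_pow_le_mul_pow y z K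
        _ = (1 + ‖y‖) ^ K * ((1 + ‖y - z‖) ^ K * ‖heatKernelGrad t (y - z)‖) := by ring
        _ ≤ (2 + ‖y₀‖) ^ K * C := by
            gcongr
            exact hC t ⟨le_rfl, le_rfl⟩ (y - z)
    rw [mul_comm] at h1
    calc ‖heatKernelGrad t (y - z)‖
        = ‖heatKernelGrad t (y - z)‖ * (1 + ‖z‖) ^ K * ((1 + ‖z‖) ^ K)⁻¹ := by
          rw [mul_assoc, mul_inv_cancel₀ hzK.ne', mul_one]
      _ ≤ (2 + ‖y₀‖) ^ K * C * ((1 + ‖z‖) ^ K)⁻¹ := by gcongr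
      _ = C * (2 + ‖y₀‖) ^ K * ((1 + ‖z‖) ^ K)⁻¹ := by ring
  have key := hasFDerivAt_integral_of_dominated_of_fderiv_le (μ := (volume : Measure E))
    (F := fun (y z : E) => heatKernel t (y - z) * f z)
    (F' := fun (y z : E) => f z • innerSL ℝ (heatKernelGrad t (y - z)))
    (x₀ := y₀) (bound := bound) (ball_mem_nhds y₀ zero_lt_one)
    (Eventually.of_forall fun y => (continuous_heatKernel_sub t y).aestronglyMeasurable.mul hfm)
    (integrable_heatKernel_mul_of_growth hfw ht y₀)
    (hfm.smul ((innerSL ℝ (E := E)).continuous.comp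
      (continuous_heatKernelGrad_sub t y₀)).aestronglyMeasurable)
    (Eventually.of_forall fun z y hy => by
      rw [norm_smul, innerSL_apply_norm, Real.norm_eq_abs, hbound]
      simp only
      rw [norm_mul, Real.norm_of_nonneg (by positivity : (0 : ℝ) ≤ ((1 + ‖z‖) ^ K)⁻¹),
        Real.norm_eq_abs]
      calc |f z| * ‖heatKernelGrad t (y - z)‖
          ≤ |f z| * (C * (2 + ‖y₀‖) ^ K * ((1 + ‖z‖) ^ K)⁻¹) :=
            mul_le_mul_of_nonneg_left (hker z y hy) (abs_nonneg _)
        _ = C * (2 + ‖y₀‖) ^ K * (((1 + ‖z‖) ^ K)⁻¹ * |f z|) := by ring)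
    hbint
    (Eventually.of_forall fun z y _ => (hasFDerivAt_heatKernel_sub_left t y z).mul_const (f z))
  -- identify the derivative with `⟪heatExtensionGrad f t y₀, ·⟫`
  have hint : Integrable (fun z => f z • heatKernelGrad t (y₀ - z)) volume :=
    integrable_smul_heatKernelGrad_of_growth hfw ht y₀
  have hint' : Integrable (fun z => f z • innerSL ℝ (heatKernelGrad t (y₀ - z))) volume := by
    refine hint.norm.mono' (hfm.smul ((innerSL ℝ (E := E)).continuous.comp
      (continuous_heatKernelGrad_sub t y₀)).aestronglyMeasurable) (Eventually.of_forall fun z => ?_)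
    rw [norm_smul, innerSL_apply_norm, norm_smul]
  have heq : (∫ z, f z • innerSL ℝ (heatKernelGrad t (y₀ - z))) =
      innerSL ℝ (heatExtensionGrad f t y₀) := by
    ext v
    rw [ContinuousLinearMap.integral_apply hint' v, innerSL_apply_apply, heatExtensionGrad,
      real_inner_comm, ← integral_inner hint v]
    refine integral_congr_ae (Eventually.of_forall fun z => ?_)
    simp only [FunLike.coe_smul, Pi.smul_apply, innerSL_apply_apply, smul_eq_mul,
      real_inner_smul_right, real_inner_comm]
  have key' : HasFDerivAt (heatExtension f t)
      (∫ z, f z • innerSL ℝ (heatKernelGrad t (y₀ - z))) y₀ := key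
  exact key'.congr_fderiv heq

/-- The caloric extension of a function of Stein growth is differentiable, with
`D(e^{tΔ}f)(y) v = ⟪heatExtensionGrad f t y, v⟫`. [folklore] -/
theorem differentiable_heatExtension_of_growth {f : E → ℝ} {K : ℕ}
    (hfw : Integrable fun w => ((1 + ‖w‖) ^ K)⁻¹ * f w) {t : ℝ} (ht : 0 < t) :
    Differentiable ℝ (heatExtension f t) ∧
      ∀ y v, fderiv ℝ (heatExtension f t) y v = ⟪heatExtensionGrad f t y, v⟫ :=
  ⟨fun y => (hasFDerivAt_heatExtension_of_growth hfw ht y).differentiableAt, fun y v => by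
    rw [(hasFDerivAt_heatExtension_of_growth hfw ht y).fderiv, innerSL_apply_apply]⟩

/-- The `BMO` case: for `f ∈ BMO(E)` and `t > 0`, `e^{tΔ}f` is differentiable with
`D(e^{tΔ}f)(y) v = ⟪heatExtensionGrad f t y, v⟫` (Grafakos Prop. 3.1.5 (ii) supplies the Stein
growth). [folklore] -/
theorem differentiable_heatExtension_of_memBMO {f : E → ℝ} (hf : MemBMO f) {t : ℝ} (ht : 0 < t) :
    Differentiable ℝ (heatExtension f t) ∧
      ∀ y v, fderiv ℝ (heatExtension f t) y v = ⟪heatExtensionGrad f t y, v⟫ :=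
  differentiable_heatExtension_of_growth (MemBMO.integrable_inv_one_add_norm_pow_mul_holds hf) ht

end HeatBMO

end Literature.Analysis.FluidPDE
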